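/-
Copyright (c) 2026. All rights reserved.
Released under Apache 2.0 license as described in the file LICENSE.
-/
import Literature.AlgebraicGeometry.ComplexMultiplication.HyperellipticJacobianDegenerateSimpleFactorExceptionalClasses
import HarnessLib

/-!
# `B•(E' ⊕ Y_{40}) = D•`: the product of the SIMPLE factors of `J_{40}` — the CM elliptic curve `E'` of `ℚ(√−2)` and the simple CM fourfold `Y_{40}` — has its Hodge ring generated by divisor classes, although `E' × Y_{40}` is NOT stably nondegenerate (Moonen–Zarhin case (g), explicit)

Family `hodge`, cell `pub-hodgecm2` (COR-CM), KEPT Literature lane `lit-deligne-3` (generation 55, file F46; sequel of F42 §4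
(`E' × Y_{40}` not stably nondegenerate), F43 (`E'² × Y_{40}` carries a `(3,3)`-class) and F40 (`X_8 × X_{40}`)).  THEOREMS ONLY: no definition,
no named fact, no `sorry`, no instance; D-0026 net debt `0`.  Nothing here asserts the algebraicity of any class; HC_CM is NOT proved.

THE POINT.  Moonen–Zarhin, Math. Ann. **315** (1999), Thm. 0.2 [corpus: paper:arxiv-math_9901113 p. 2]: «(3) Suppose we are in case (g). Then
`B•(X) = D•(X)` but `Hg(X) ≠ Hg(E) × Hg(Y)`», case (g) being `X ∼ E × Y`, `E` a CM elliptic curve with field `k`, `Y` a simple fourfold of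
type IV with `k ↪ End⁰(Y)` acting with multiplicities `(1, 3)` (§5 Case 2 [p. 10]: the Weil classes live on `Z = E² × Y`).  Inside `J_{40}`:
`X_8 ∼ E'²` (`E'` with CM by `ℚ(ζ_8 − ζ_8^{−1}) = ℚ(√−2)`), `X_{40} ∼ Y_{40}²` (GGL Thm. 3.0 (5)); F42 §4 proved `E' × Y_{40}` NOT stably
nondegenerate, F43 located a `(3,3)`-class on `E'² × Y_{40}`, F40 one on `E'² × Y_{40}²`.  THIS file proves the other half of (g)(3) for this
explicit pair: **`B•(E' ⊕ Y_{40}) = D•(E' ⊕ Y_{40})`** (`IsDivisorGenerated`) — every rational Hodge class on `E' ⊕ Y_{40}` itself is a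
polynomial in divisor classes.

THE MECHANISM (Pohlmann's criterion for the CM algebra `L_8 × L_{40}`, `L_d = ℚ(ζ_d − ζ_d^{−1})`, index `2` in `ℚ(ζ_d)`).  A balanced weight
`T ⊆ Hom(L_8, ℂ) ⊔ Hom(L_{40}, ℂ)` is pushed along a CANONICAL SECTION `S` of restriction (§2 `exists_canonical_lift`: of the two lifts of `ρ`,
exponents `e + e' ≡ d/2`, exactly one has lifted residue `t ∈ ℤ/40` with `⟨t⟩ mod 20 < 10`) — a pattern-preserving injection (F42 §0), so
`S(T)` is balanced with all residue points among the ten canonical points `(0;5), (0;25), (1;1), (1;3), (1;7), (1;9), (1;21), (1;23), (1;27),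
(1;29)`.  Balance at the units `g = 1, 3, 7, 9` of `ℤ/40` (§1 `card_filter_half_lift_eq_of_isGaloisBalancedAlg`: an automorphism of character
`g` exists) gives four linear identities among the ten indicators; they force (§2 `antipodal_of_four_balances`, `omega`: the pattern vectors of
`(1;1), (1;3), (1;7), (1;9)` are a Walsh basis and that of `(0;5)` is half their signed sum) the set to be ANTIPODALLY CLOSED: with `(i; t)` also
`(i; t + 20)`.  Antipodal points form balanced pairs (§1), so `S(T)` is a disjoint union of balanced pairs (§1 `mem_pohlmannDivisorSetsAlg_of_antipodal`),
and divisoriality pulls back to `T` (F42 §0).  Hence `pohlmannSetsAlg Ψ m ⊆ pohlmannDivisorSetsAlg Ψ m` for all `m`, and the tree's dictionary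
`exists_exceptional_biproduct_iff` leaves no exceptional class on `B_0 ⊕ B_1 = E' ⊕ Y_{40}`.

WHAT IS PROVED.
* §1 (levels `d_i ∣ 40`, lower-half types, any number of members) **`card_filter_half_lift_eq_of_isGaloisBalancedAlg`** (balance read on lifted
  residues), **`pair_mem_pohlmannSetsAlg_one_of_lift_eq_add`** (antipodal points are a balanced pair), **`mem_pohlmannDivisorSetsAlg_of_antipodal`**
  (an antipodally closed `2n`-set with injective odd lifts is a disjoint union of `n` balanced pairs).
* §2 (the pair `(8, 40)`) `mem_ten_of_canonical`, **`antipodal_of_four_balances`** (the certificate, by `omega`), `lift_val_odd`,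
  **`antipodal_of_isGaloisBalancedAlg_of_canonical`**, **`exists_canonical_lift`**.
* §3 **`pohlmannSetsAlg_subset_pohlmannDivisorSetsAlg_subPair_eight_forty`** (every balanced weight of `(L_8 ⊔ L_{40}; Ψ)` is divisorial),
  **`exists_simpleFactors_isDivisorGenerated_of_lev_eq_eight_forty`** (F42 §4's nineteen conjuncts + `∀ m, pohlmannSetsAlg ⊆ pohlmannDivisorSetsAlg`
  + `IsDivisorGenerated (⨁ B)`), hypothesis-free **`exists_cmCurve_simple_fourfold_isDivisorGenerated_not_isStablyNondegenerate`**: simple `B_0`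
  (dim `1`), `B_1` (dim `4`), stably nondegenerate, `Hom = 0` both ways, `B_0 × B_1` (dim `5`) NOT stably nondegenerate, `IsDivisorGenerated (⨁ B)`.
* §4 **`zetaOf_pow_sub_inv_mem_and_sq_eq_neg_two_of_eq_adjoin`** (`m = 8q`, `q` odd, `q ≠ 3`): `ζ^q − ζ^{−q} ∈ ℚ(ζ − ζ^{−1})` with square `−2` —
  `√−2 ∈ L_{40}`: the CM field `ℚ(√−2)` of `E'` embeds into the CM field of `Y_{40}` (the case (g) hypothesis `k ↪ End⁰(Y)` on the field level).
* §5 **`exists_simpleFactors_hodgeConjectureFor_of_lev_eq_eight_forty`**, hypothesis-free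
  **`exists_cmCurve_simple_fourfold_hodgeConjectureFor_not_isStablyNondegenerate`**: THE HODGE CONJECTURE HOLDS FOR `E' ⊕ Y_{40}` (`B• = D•` and
  Lefschetz (1,1) via the tree's `hodgeConjectureFor_of_isDivisorGenerated`) — although `E' × Y_{40}` is NOT stably nondegenerate.

HONEST.  Assembled from F42 (sub-pair data, pattern transport), F45 (`exists_fibre_pair`), the tree's residue calculus (`comp_mem_iff_half_lift`,
`exists_autExp_eq`) plus the new §1–§2.  The Hodge-ring statement is for the biproduct `B_0 ⊕ B_1` (the tree's dictionary object; `≅ B_0 × B_1`);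
the identification `k = ℚ(√−2) ↪ End⁰(Y_{40})` with multiplicities `(1,3)` and `Hg(E' × Y_{40})` are NOT typed; numerics (folder `tools/`): the
32 balanced subsets of the ten canonical points are exactly the unions of the 5 antipodal pairs.  No algebraicity claim.

## References
* [MoonenZarhin1999LowDim] B. Moonen, Yu. Zarhin, Math. Ann. 315 (1999) 711–733: Thm. 0.2 (3), §5 Case 2 [corpus: paper:arxiv-math_9901113 pp. 2, 10].
  [cite: MoonenZarhin1999LowDim, Thm. 0.2 (3) and §5 Case 2]
* [GalleseGoodsonLombardo2024] Gallese–Goodson–Lombardo, §3 Thm. 3.0 (5), §3.2 Lemma 11–12. [cite: GalleseGoodsonLombardo2024, §3 Thm. 3.0 (5) and §3.2 Lemma 11]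
* [Pohlmann1968] H. Pohlmann, Ann. of Math. (2) 88 (1968), Thm. 1. [cite: Pohlmann1968, Thm. 1]
* [Gordon1999HodgeAVSurvey] B. B. Gordon (1999), 9.2.2, §9.3, Thm. 7.6.2. [cite: Gordon1999HodgeAVSurvey, 9.2.2 and Thm. 7.6.2]
* [GaoUllmo2025] Z. Gao, E. Ullmo, Thm. 3.1 (3.2). [cite: GaoUllmo2025, Thm. 3.1]
* [Goodson2024DegeneracyFermat] H. Goodson (2024), Lemma 4.2, §3.1. [cite: Goodson2024DegeneracyFermat, Lemma 4.2]
* [Washington1997] L. C. Washington, *Introduction to Cyclotomic Fields*, Thm. 2.5. [cite: Washington1997, Thm. 2.5]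
* [Shimura1998] G. Shimura (1998), §6.2 Thm. 3, §8.2 Prop. 26. [cite: Shimura1998, §6.2 Thm. 3 and §8.2 Prop. 26]
* [vanGeemen1994HodgeAV] B. van Geemen, LNM 1594 (1994), §2.4–2.5. [cite: vanGeemen1994HodgeAV, §2.4]
-/

open CategoryTheory CategoryTheory.Limits NumberField Module

namespace Literature.AlgebraicGeometry.ComplexMultiplication

open Literature.AlgebraicGeometry.Motives
open Literature.AlgebraicGeometry.Motives.AbelianVariety
open Literature.AlgebraicGeometry.HodgeTheory (complexBetti IsRationalClass IsOfHodgeType IsStablyNondegenerate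
  IsDivisorGenerated HodgeConjectureFor)
open Literature.AlgebraicGeometry.VanGeemen1994 (hodgeClassSpan)
open Literature.Barriers.HodgeConjecture (divisorClassesSpan)
open Literature.NumberTheory.ComplexMultiplication

namespace HyperellipticJacobian

open Literature.AlgebraicGeometry.Pohlmann1968 Literature.AlgebraicGeometry.Pohlmann1968.Cyclotomic
open Literature.AlgebraicGeometry.Pohlmann1968.CMAlgebra

/-! ## §1 Lifted residues in `ℤ/40`: balance read on residues, antipodal pairs, divisoriality from an antipodal pairing -/

section Pairing

variable {k : ℕ} {lev : Fin k → ℕ} [∀ i, NeZero (lev i)] {K : Fin k → Type} [∀ i, Field (K i)]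
  [∀ i, NumberField (K i)] [∀ i, IsCyclotomicExtension {lev i} ℚ (K i)] {Φ : ∀ i, CMType (K i)}

/-- A residue coprime to `40` is odd. [folklore] -/
private theorem mod_two_of_coprime_forty {v : ℕ} (h : v.Coprime 40) : v % 2 = 1 := by
  by_contra hv
  have h2 : 2 ∣ v := by omega
  have := Nat.dvd_gcd h2 (by norm_num : 2 ∣ 40)
  rw [h] at this
  omega

/-- Translation by `20` flips the half of an odd multiple: `2⟨g(t + 20)⟩ < 40 ⟺ ¬ 2⟨g t⟩ < 40` for odd `g`, `t`. [folklore] -/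
private theorem half_flip : ∀ g t : ZMod 40, g.val % 2 = 1 → t.val % 2 = 1 →
    (2 * (g * (t + 20)).val < 40 ↔ ¬2 * (g * t).val < 40) := by
  decide

/-- **Balance read on the lifted residues.**  If `W ⊆ ⊔_i Hom(ℚ(ζ_{d_i}), ℂ)` (`d_i ∣ 40`, lower-half types) satisfies Pohlmann's
condition, then for every unit `g` of `ℤ/40` as many members of `W` have `2⟨g · lift⟩ < 40` as not (an automorphism of character `g`
exists, `exists_autExp_eq`; membership is read on the lift, `comp_mem_iff_half_lift`). [cite: GaoUllmo2025, Thm. 3.1 (3.2)]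
[cite: Washington1997, Thm. 2.5] [cite: Goodson2024DegeneracyFermat, Lemma 4.2] -/
theorem card_filter_half_lift_eq_of_isGaloisBalancedAlg (hdvd : ∀ i, lev i ∣ 40)
    (hΦ : ∀ i (σ : K i →+* ℂ), σ ∈ (Φ i).1 ↔ 2 * (expOf (lev i) (K i) σ).val < lev i)
    {W : Finset ((i : Fin k) × (K i →+* ℂ))} (hW : IsGaloisBalancedAlg Φ W) {g : ZMod 40} (hg : g.val.Coprime 40) :
    (W.filter fun x => 2 * (g * ((40 / lev x.1 * (expOf (lev x.1) (K x.1) x.2).val : ℕ) : ZMod 40)).val < 40).card =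
      (W.filter fun x => ¬2 * (g * ((40 / lev x.1 * (expOf (lev x.1) (K x.1) x.2).val : ℕ) : ZMod 40)).val < 40).card := by
  classical
  obtain ⟨τ, hτ⟩ := exists_autExp_eq (n := 40) g hg
  have h := hW τ
  have e1 : {x | x ∈ W ∧ (τ : ℂ →+* ℂ).comp x.2 ∈ (Φ x.1).1} =
      ((W.filter fun x => 2 * (g * ((40 / lev x.1 * (expOf (lev x.1) (K x.1) x.2).val : ℕ) : ZMod 40)).val < 40 :
        Finset _) : Set _) := by
    ext x
    rw [Set.mem_setOf_eq, Finset.coe_filter, Set.mem_setOf_eq, comp_mem_iff_half_lift (M := 40) hdvd hΦ τ x, hτ]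
  have e2 : {x | x ∈ W ∧ (τ : ℂ →+* ℂ).comp x.2 ∉ (Φ x.1).1} =
      ((W.filter fun x => ¬2 * (g * ((40 / lev x.1 * (expOf (lev x.1) (K x.1) x.2).val : ℕ) : ZMod 40)).val < 40 :
        Finset _) : Set _) := by
    ext x
    rw [Set.mem_setOf_eq, Finset.coe_filter, Set.mem_setOf_eq, comp_mem_iff_half_lift (M := 40) hdvd hΦ τ x, hτ]
  rw [e1, e2, Set.ncard_coe_finset, Set.ncard_coe_finset] at h
  exact h

/-- A pair `{a, b}` on which `Q` holds at exactly one point has exactly one member with `Q`. [folklore] -/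
private theorem ncard_sep_pair_eq_one {α : Type*} [DecidableEq α] {a b : α} (hab : a ≠ b) (Q : α → Prop)
    (h : Q a ↔ ¬Q b) : {x | x ∈ ({a, b} : Finset α) ∧ Q x}.ncard = 1 := by
  by_cases ha : Q a
  · have hset : {x | x ∈ ({a, b} : Finset α) ∧ Q x} = {a} := by
      ext x
      simp only [Set.mem_setOf_eq, Finset.mem_insert, Finset.mem_singleton, Set.mem_singleton_iff]
      constructor
      · rintro ⟨rfl | rfl, hq⟩
        · rfl
        · exact absurd hq (h.1 ha)
      · rintro rfl
        exact ⟨Or.inl rfl, ha⟩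
    rw [hset, Set.ncard_singleton]
  · have hb : Q b := by
      by_contra hb
      exact ha (h.2 hb)
    have hset : {x | x ∈ ({a, b} : Finset α) ∧ Q x} = {b} := by
      ext x
      simp only [Set.mem_setOf_eq, Finset.mem_insert, Finset.mem_singleton, Set.mem_singleton_iff]
      constructor
      · rintro ⟨rfl | rfl, hq⟩
        · exact absurd hq ha
        · rfl
      · rintro rfl
        exact ⟨Or.inr rfl, hb⟩
    rw [hset, Set.ncard_singleton]

/-- **ANTIPODAL POINTS FORM A BALANCED PAIR**: two points whose lifted residues differ by `20 = 40/2` (odd lifts) have complementary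
patterns — every `τ ∈ Aut(ℂ)` moves exactly one of them into its type. [cite: Pohlmann1968, Thm. 1] [cite: Gordon1999HodgeAVSurvey, 9.2.2]
[cite: Washington1997, Thm. 2.5] -/
theorem pair_mem_pohlmannSetsAlg_one_of_lift_eq_add [DecidableEq ((i : Fin k) × (K i →+* ℂ))] (hdvd : ∀ i, lev i ∣ 40)
    (hΦ : ∀ i (σ : K i →+* ℂ), σ ∈ (Φ i).1 ↔ 2 * (expOf (lev i) (K i) σ).val < lev i)
    {x y : (i : Fin k) × (K i →+* ℂ)}
    (hodd : ((40 / lev x.1 * (expOf (lev x.1) (K x.1) x.2).val : ℕ) : ZMod 40).val % 2 = 1)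
    (hxy : ((40 / lev y.1 * (expOf (lev y.1) (K y.1) y.2).val : ℕ) : ZMod 40) =
      ((40 / lev x.1 * (expOf (lev x.1) (K x.1) x.2).val : ℕ) : ZMod 40) + 20) :
    ({x, y} : Finset ((i : Fin k) × (K i →+* ℂ))) ∈ pohlmannSetsAlg Φ 1 := by
  classical
  have hne : x ≠ y := by
    rintro rfl
    have h := congrArg ZMod.val hxy
    rw [ZMod.val_add] at h
    have h20 : (20 : ZMod 40).val = 20 := rfl
    rw [h20] at h
    have hlt := ZMod.val_lt ((40 / lev x.1 * (expOf (lev x.1) (K x.1) x.2).val : ℕ) : ZMod 40)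
    omega
  refine ⟨Finset.card_pair hne, fun τ => ?_⟩
  have hg : (autExp 40 τ).val % 2 = 1 := mod_two_of_coprime_forty (coprime_autExp 40 τ)
  have hflip := half_flip (autExp 40 τ) _ hg hodd
  have H1 : (τ : ℂ →+* ℂ).comp x.2 ∈ (Φ x.1).1 ↔ ¬(τ : ℂ →+* ℂ).comp y.2 ∈ (Φ y.1).1 := by
    rw [comp_mem_iff_half_lift (M := 40) hdvd hΦ τ x, comp_mem_iff_half_lift (M := 40) hdvd hΦ τ y, hxy, hflip, not_not]
  rw [ncard_sep_pair_eq_one hne (fun z => (τ : ℂ →+* ℂ).comp z.2 ∈ (Φ z.1).1) H1,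
    ncard_sep_pair_eq_one hne (fun z => (τ : ℂ →+* ℂ).comp z.2 ∉ (Φ z.1).1) (not_congr H1)]

/-- **DIVISORIALITY FROM AN ANTIPODAL PAIRING.**  Let `W` be a `2n`-subset of `⊔_i Hom(ℚ(ζ_{d_i}), ℂ)` on which the lifted-residue map
`x ↦ (i, lift x)` is injective, all lifts odd, and such that with every point `W` contains a point of the same member with lift `+20`.
Then `W` is a disjoint union of `n` balanced (antipodal) pairs. [cite: Gordon1999HodgeAVSurvey, 9.2.2] [cite: vanGeemen1994HodgeAV, §2.4] -/
theorem mem_pohlmannDivisorSetsAlg_of_antipodal [DecidableEq ((i : Fin k) × (K i →+* ℂ))] (hdvd : ∀ i, lev i ∣ 40)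
    (hΦ : ∀ i (σ : K i →+* ℂ), σ ∈ (Φ i).1 ↔ 2 * (expOf (lev i) (K i) σ).val < lev i) :
    ∀ (n : ℕ) (W : Finset ((i : Fin k) × (K i →+* ℂ))), W.card = 2 * n →
      (∀ x ∈ W, ∀ y ∈ W, x.1 = y.1 →
        ((40 / lev x.1 * (expOf (lev x.1) (K x.1) x.2).val : ℕ) : ZMod 40) =
          ((40 / lev y.1 * (expOf (lev y.1) (K y.1) y.2).val : ℕ) : ZMod 40) → x = y) →
      (∀ x ∈ W, ((40 / lev x.1 * (expOf (lev x.1) (K x.1) x.2).val : ℕ) : ZMod 40).val % 2 = 1) →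
      (∀ x ∈ W, ∃ y ∈ W, y.1 = x.1 ∧
        ((40 / lev y.1 * (expOf (lev y.1) (K y.1) y.2).val : ℕ) : ZMod 40) =
          ((40 / lev x.1 * (expOf (lev x.1) (K x.1) x.2).val : ℕ) : ZMod 40) + 20) →
      W ∈ pohlmannDivisorSetsAlg Φ n
  | 0, W, hcard, _, _, _ => by
    rw [Nat.mul_zero, Finset.card_eq_zero] at hcard
    subst hcard
    rw [pohlmannDivisorSetsAlg_def, mem_disjointUnionsOf_zero]
  | n + 1, W, hcard, hinj, hodd, hpair => by
    classical
    obtain ⟨x, hx⟩ : W.Nonempty := Finset.card_pos.1 (by omega)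
    obtain ⟨y, hy, hy1, hyx⟩ := hpair x hx
    have h40 : ∀ z : (i : Fin k) × (K i →+* ℂ),
        ((40 / lev z.1 * (expOf (lev z.1) (K z.1) z.2).val : ℕ) : ZMod 40) + 20 + 20 =
          ((40 / lev z.1 * (expOf (lev z.1) (K z.1) z.2).val : ℕ) : ZMod 40) := fun z => by
      rw [add_assoc, show (20 : ZMod 40) + 20 = 0 by decide, add_zero]
    have hxy : x ≠ y := by
      rintro rfl
      have h := congrArg ZMod.val hyx
      rw [ZMod.val_add] at h
      have h20 : (20 : ZMod 40).val = 20 := rfl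
      rw [h20] at h
      have hlt := ZMod.val_lt ((40 / lev x.1 * (expOf (lev x.1) (K x.1) x.2).val : ℕ) : ZMod 40)
      omega
    set W' := (W.erase x).erase y with hW'
    have hyW : y ∈ W.erase x := Finset.mem_erase.2 ⟨fun h => hxy h.symm, hy⟩
    have hcard' : W'.card = 2 * n := by
      rw [hW', Finset.card_erase_of_mem hyW, Finset.card_erase_of_mem hx, hcard]
      omega
    have hsub : W' ⊆ W := fun z hz => Finset.mem_of_mem_erase (Finset.mem_of_mem_erase hz)
    have hmemW' : ∀ z, z ∈ W' ↔ z ∈ W ∧ z ≠ x ∧ z ≠ y := fun z => by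
      rw [hW', Finset.mem_erase, Finset.mem_erase]
      tauto
    have hpair' : ∀ z ∈ W', ∃ w ∈ W', w.1 = z.1 ∧
        ((40 / lev w.1 * (expOf (lev w.1) (K w.1) w.2).val : ℕ) : ZMod 40) =
          ((40 / lev z.1 * (expOf (lev z.1) (K z.1) z.2).val : ℕ) : ZMod 40) + 20 := by
      intro z hz
      obtain ⟨hzW, hzx, hzy⟩ := (hmemW' z).1 hz
      obtain ⟨w, hw, hw1, hwz⟩ := hpair z hzW
      refine ⟨w, (hmemW' w).2 ⟨hw, ?_, ?_⟩, hw1, hwz⟩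
      · rintro rfl
        -- `w = x`: then `lift y = lift x + 20 = lift z + 20 + 20 = lift z`, `z.1 = y.1`, so `z = y`
        apply hzy
        refine hinj z hzW y hy (hw1.symm.trans hy1.symm) ?_
        rw [hyx, hwz, h40 z]
      · rintro rfl
        -- `w = y`: then `lift z + 20 = lift y = lift x + 20`, so `lift z = lift x`, `z = x`
        apply hzx
        refine hinj z hzW x hx (hw1.symm.trans hy1) ?_
        exact add_right_cancel (hwz.symm.trans hyx)
    have IH := mem_pohlmannDivisorSetsAlg_of_antipodal hdvd hΦ n W' hcard'
      (fun z hz w hw => hinj z (hsub hz) w (hsub hw)) (fun z hz => hodd z (hsub hz)) hpair'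
    have hpairxy : ({x, y} : Finset ((i : Fin k) × (K i →+* ℂ))) ∈ pohlmannSetsAlg Φ 1 :=
      pair_mem_pohlmannSetsAlg_one_of_lift_eq_add hdvd hΦ (hodd x hx) hyx
    have hdisj : Disjoint W' {x, y} := by
      rw [Finset.disjoint_insert_right, Finset.disjoint_singleton_right]
      exact ⟨fun h => ((hmemW' x).1 h).2.1 rfl, fun h => ((hmemW' y).1 h).2.2 rfl⟩
    have hWeq : W = W'.disjUnion {x, y} hdisj := by
      ext z
      rw [Finset.mem_disjUnion, hmemW', Finset.mem_insert, Finset.mem_singleton]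
      constructor
      · intro hz
        by_cases hzx : z = x
        · exact Or.inr (Or.inl hzx)
        by_cases hzy : z = y
        · exact Or.inr (Or.inr hzy)
        · exact Or.inl ⟨hz, hzx, hzy⟩
      · rintro (⟨hz, -, -⟩ | rfl | rfl)
        · exact hz
        · exact hx
        · exact hy
    rw [hWeq, pohlmannDivisorSetsAlg_def, mem_disjointUnionsOf_succ]
    exact ⟨W', by rwa [pohlmannDivisorSetsAlg_def] at IH, {x, y}, hpairxy, hdisj, rfl⟩

end Pairing

/-! ## §2 The pair `(8, 40)`: canonical lifts, the ten residue points, and the certificate «balanced ⟹ antipodally closed» -/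

section EightForty

variable {lev : Fin 2 → ℕ} [∀ i, NeZero (lev i)] {K : Fin 2 → Type} [∀ i, Field (K i)] [∀ i, NumberField (K i)]
  [∀ i, IsCyclotomicExtension {lev i} ℚ (K i)] {Φ : ∀ i, CMType (K i)}

omit [∀ i, NeZero (lev i)] [∀ i, NumberField (K i)] [∀ i, IsCyclotomicExtension {lev i} ℚ (K i)] in
/-- The levels `8, 40` divide `40`. [folklore] -/
private theorem dvd_forty (h0 : lev 0 = 8) (h1 : lev 1 = 40) : ∀ i, lev i ∣ 40 :=
  Fin.forall_fin_two.2 ⟨by rw [h0]; norm_num, by rw [h1]⟩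

omit [∀ i, NeZero (lev i)] [∀ i, NumberField (K i)] [∀ i, IsCyclotomicExtension {lev i} ℚ (K i)] in
/-- `⟨(40/d)·s⟩ = (40/d)·⟨s⟩` for `s ∈ ℤ/d`, `d ∣ 40`. [folklore] -/
private theorem val_lift_forty {d : ℕ} [NeZero d] (hd : d ∣ 40) (s : ZMod d) :
    (((40 / d * s.val : ℕ) : ZMod 40)).val = 40 / d * s.val := by
  apply ZMod.val_natCast_of_lt
  have hs := ZMod.val_lt s
  have hpos : 0 < 40 / d := Nat.div_pos (Nat.le_of_dvd (by norm_num) hd) (Nat.pos_of_ne_zero (NeZero.ne d))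
  calc 40 / d * s.val < 40 / d * d := (Nat.mul_lt_mul_left hpos).2 hs
    _ = 40 := Nat.div_mul_cancel hd

omit [∀ i, NeZero (lev i)] [∀ i, NumberField (K i)] [∀ i, IsCyclotomicExtension {lev i} ℚ (K i)] in
/-- The lift `s ↦ (40/d)·s` is injective on `ℤ/d`. [folklore] -/
private theorem lift_injective_forty {d : ℕ} [NeZero d] (hd : d ∣ 40) {s s' : ZMod d}
    (h : ((40 / d * s.val : ℕ) : ZMod 40) = ((40 / d * s'.val : ℕ) : ZMod 40)) : s = s' := by
  have hv := congrArg ZMod.val h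
  rw [val_lift_forty hd, val_lift_forty hd] at hv
  have hpos : 0 < 40 / d := Nat.div_pos (Nat.le_of_dvd (by norm_num) hd) (Nat.pos_of_ne_zero (NeZero.ne d))
  exact ZMod.val_injective d (Nat.eq_of_mul_eq_mul_left hpos hv)

/-- **The canonical residue points.**  A point of `Hom(ℚ(ζ_8), ℂ) ⊔ Hom(ℚ(ζ_40), ℂ)` whose lift `t ∈ ℤ/40` (`5e` resp. `e`) is CANONICAL
(`⟨t⟩ mod 20 < 10`) has `(member, lift)` among the ten points `(0;5), (0;25), (1;1), (1;3), (1;7), (1;9), (1;21), (1;23), (1;27), (1;29)`.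
[cite: Washington1997, Thm. 2.5] [cite: GalleseGoodsonLombardo2024, §3.2 Lemma 11] -/
theorem mem_ten_of_canonical (h0 : lev 0 = 8) (h1 : lev 1 = 40) (x : (i : Fin 2) × (K i →+* ℂ))
    (hcan : ((40 / lev x.1 * (expOf (lev x.1) (K x.1) x.2).val : ℕ) : ZMod 40).val % 20 < 10) :
    (⟨x.1, ((40 / lev x.1 * (expOf (lev x.1) (K x.1) x.2).val : ℕ) : ZMod 40)⟩ : Fin 2 × ZMod 40) ∈
      ({(0, 5), (0, 25), (1, 1), (1, 3), (1, 7), (1, 9), (1, 21), (1, 23), (1, 27), (1, 29)} : Finset (Fin 2 × ZMod 40)) := by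
  suffices H : ∀ (i : Fin 2) (σ : K i →+* ℂ),
      ((40 / lev i * (expOf (lev i) (K i) σ).val : ℕ) : ZMod 40).val % 20 < 10 →
      (⟨i, ((40 / lev i * (expOf (lev i) (K i) σ).val : ℕ) : ZMod 40)⟩ : Fin 2 × ZMod 40) ∈
        ({(0, 5), (0, 25), (1, 1), (1, 3), (1, 7), (1, 9), (1, 21), (1, 23), (1, 27), (1, 29)} :
          Finset (Fin 2 × ZMod 40)) from H x.1 x.2 hcan
  refine Fin.forall_fin_two.2 ⟨fun σ => ?_, fun σ => ?_⟩
  · have hcop := coprime_expOf (lev 0) (K 0) σ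
    have hlt := ZMod.val_lt (expOf (lev 0) (K 0) σ)
    revert hcop hlt
    generalize (expOf (lev 0) (K 0) σ).val = a
    rw [h0]
    intro hcop hlt
    interval_cases a <;> revert hcop <;> decide
  · have hcop := coprime_expOf (lev 1) (K 1) σ
    have hlt := ZMod.val_lt (expOf (lev 1) (K 1) σ)
    revert hcop hlt
    generalize (expOf (lev 1) (K 1) σ).val = a
    rw [h1]
    intro hcop hlt
    interval_cases a <;> revert hcop <;> decide

/-- **THE CERTIFICATE «BALANCED ⟹ ANTIPODALLY CLOSED» for subsets of the ten canonical points**, in the form `omega` consumes: for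
`a_j` the indicators of the ten points (`a_{(0;5)}, a_{(0;25)} ≤ 1` suffices), the four balance identities at the units `g = 1, 3, 7, 9` of `ℤ/40` force
`a_{(0;5)} = a_{(0;25)}`, `a_{(1;t)} = a_{(1;t+20)}` (`t = 1, 3, 7, 9`) — the four pattern vectors of `(1;1), (1;3), (1;7), (1;9)` are the Walsh
basis of `ℤ^4` and that of `(0;5)` is half their signed sum. [cite: Pohlmann1968, Thm. 1] [cite: GaoUllmo2025, Thm. 3.1 (3.2)] -/
theorem antipodal_of_four_balances {a0 a1 a2 a3 a4 a5 a6 a7 a8 a9 : ℕ} (h0 : a0 ≤ 1) (h1 : a1 ≤ 1)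
    (g1 : a0 + a2 + a3 + a4 + a5 = a1 + a6 + a7 + a8 + a9) (g3 : a0 + a2 + a3 + a8 + a9 = a1 + a4 + a5 + a6 + a7)
    (g7 : a1 + a2 + a4 + a7 + a9 = a0 + a3 + a5 + a6 + a8) (g9 : a0 + a2 + a5 + a7 + a8 = a1 + a3 + a4 + a6 + a9) :
    a0 = a1 ∧ a2 = a6 ∧ a3 = a7 ∧ a4 = a8 ∧ a5 = a9 := by
  omega

/-- The members of `W` with a given residue point: at most one (the lift is injective on each member). [folklore] -/
private theorem card_filter_lift_eq_le_one [DecidableEq ((i : Fin 2) × (K i →+* ℂ))] (h0 : lev 0 = 8) (h1 : lev 1 = 40)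
    (W : Finset ((i : Fin 2) × (K i →+* ℂ))) (r : Fin 2 × ZMod 40) :
    (W.filter fun x => (⟨x.1, ((40 / lev x.1 * (expOf (lev x.1) (K x.1) x.2).val : ℕ) : ZMod 40)⟩ : Fin 2 × ZMod 40) = r).card ≤ 1 := by
  refine Finset.card_le_one.2 fun x hx y hy => ?_
  rw [Finset.mem_filter] at hx hy
  have h := hx.2.trans hy.2.symm
  simp only [Prod.mk.injEq] at h
  obtain ⟨hi, hl⟩ := h
  obtain ⟨i, σ⟩ := x
  obtain ⟨i', σ'⟩ := y
  dsimp only at hi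
  subst hi
  have := lift_injective_forty (dvd_forty h0 h1 i) hl
  dsimp only at this
  rw [expOf_injective (lev i) (K i) this]

/-- **Injectivity of `x ↦ (member, lift)` on points of the same member.** [folklore] -/
private theorem eq_of_lift_eq (h0 : lev 0 = 8) (h1 : lev 1 = 40) (x y : (i : Fin 2) × (K i →+* ℂ)) (hi : x.1 = y.1)
    (hl : ((40 / lev x.1 * (expOf (lev x.1) (K x.1) x.2).val : ℕ) : ZMod 40) =
      ((40 / lev y.1 * (expOf (lev y.1) (K y.1) y.2).val : ℕ) : ZMod 40)) : x = y := by
  obtain ⟨i, σ⟩ := x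
  obtain ⟨i', σ'⟩ := y
  dsimp only at hi
  subst hi
  have := lift_injective_forty (dvd_forty h0 h1 i) hl
  dsimp only at this
  rw [expOf_injective (lev i) (K i) this]

/-- Counting the members of `W` in a given half through the residue points: if every point of `W` has its residue point in the finite
set `S`, then `#{x ∈ W : P(point x)} = Σ_{r ∈ S, P r} #{x ∈ W : point x = r}`. [folklore] -/
private theorem card_filter_eq_sum [DecidableEq ((i : Fin 2) × (K i →+* ℂ))] (W : Finset ((i : Fin 2) × (K i →+* ℂ)))
    (S : Finset (Fin 2 × ZMod 40))
    (hS : ∀ x ∈ W, (⟨x.1, ((40 / lev x.1 * (expOf (lev x.1) (K x.1) x.2).val : ℕ) : ZMod 40)⟩ : Fin 2 × ZMod 40) ∈ S)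
    (P : Fin 2 × ZMod 40 → Prop) [DecidablePred P] :
    (W.filter fun x => P ⟨x.1, ((40 / lev x.1 * (expOf (lev x.1) (K x.1) x.2).val : ℕ) : ZMod 40)⟩).card =
      ∑ r ∈ S.filter P, (W.filter fun x =>
        (⟨x.1, ((40 / lev x.1 * (expOf (lev x.1) (K x.1) x.2).val : ℕ) : ZMod 40)⟩ : Fin 2 × ZMod 40) = r).card := by
  rw [Finset.card_eq_sum_card_fiberwise (t := S.filter P)
    (f := fun x => (⟨x.1, ((40 / lev x.1 * (expOf (lev x.1) (K x.1) x.2).val : ℕ) : ZMod 40)⟩ : Fin 2 × ZMod 40))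
    (fun x hx => by
      rw [Finset.coe_filter, Set.mem_setOf_eq] at hx
      exact Finset.mem_coe.2 (Finset.mem_filter.2 ⟨hS x hx.1, hx.2⟩))]
  refine Finset.sum_congr rfl fun r hr => ?_
  rw [Finset.mem_filter] at hr
  congr 1
  ext x
  simp only [Finset.mem_filter]
  constructor
  · rintro ⟨⟨hx, -⟩, h⟩
    exact ⟨hx, h⟩
  · rintro ⟨hx, h⟩
    exact ⟨⟨hx, by rw [h]; exact hr.2⟩, h⟩

/-- **BALANCED SETS OF CANONICAL POINTS ARE ANTIPODALLY CLOSED.**  If `W ⊆ Hom(ℚ(ζ_8), ℂ) ⊔ Hom(ℚ(ζ_40), ℂ)` consists of points with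
canonical lifts and satisfies Pohlmann's condition for the lower-half types, then with every point `W` contains the point of the same
member with the antipodal lift `+20` (the four balance identities at `g = 1, 3, 7, 9` and `antipodal_of_four_balances`).
[cite: Pohlmann1968, Thm. 1] [cite: GaoUllmo2025, Thm. 3.1 (3.2)] [cite: GalleseGoodsonLombardo2024, §3.2 Lemma 11–12] -/
theorem antipodal_of_isGaloisBalancedAlg_of_canonical (h0 : lev 0 = 8) (h1 : lev 1 = 40)
    (hΦ : ∀ i (σ : K i →+* ℂ), σ ∈ (Φ i).1 ↔ 2 * (expOf (lev i) (K i) σ).val < lev i)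
    {W : Finset ((i : Fin 2) × (K i →+* ℂ))} (hW : IsGaloisBalancedAlg Φ W)
    (hcan : ∀ x ∈ W, ((40 / lev x.1 * (expOf (lev x.1) (K x.1) x.2).val : ℕ) : ZMod 40).val % 20 < 10) :
    ∀ x ∈ W, ∃ y ∈ W, y.1 = x.1 ∧
      ((40 / lev y.1 * (expOf (lev y.1) (K y.1) y.2).val : ℕ) : ZMod 40) =
        ((40 / lev x.1 * (expOf (lev x.1) (K x.1) x.2).val : ℕ) : ZMod 40) + 20 := by
  classical
  set S : Finset (Fin 2 × ZMod 40) :=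
    {(0, 5), (0, 25), (1, 1), (1, 3), (1, 7), (1, 9), (1, 21), (1, 23), (1, 27), (1, 29)} with hSdef
  have hS : ∀ x ∈ W, (⟨x.1, ((40 / lev x.1 * (expOf (lev x.1) (K x.1) x.2).val : ℕ) : ZMod 40)⟩ : Fin 2 × ZMod 40) ∈ S :=
    fun x hx => mem_ten_of_canonical h0 h1 x (hcan x hx)
  -- the indicators of the ten points
  set a : Fin 2 × ZMod 40 → ℕ := fun r => (W.filter fun x =>
    (⟨x.1, ((40 / lev x.1 * (expOf (lev x.1) (K x.1) x.2).val : ℕ) : ZMod 40)⟩ : Fin 2 × ZMod 40) = r).card with hadef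
  have hle : ∀ r, a r ≤ 1 := fun r => card_filter_lift_eq_le_one h0 h1 W r
  -- the four balance identities, read on the ten points
  have hbal : ∀ g : ZMod 40, g.val.Coprime 40 →
      ∑ r ∈ S.filter (fun r => 2 * (g * r.2).val < 40), a r = ∑ r ∈ S.filter (fun r => ¬2 * (g * r.2).val < 40), a r := by
    intro g hg
    have h := card_filter_half_lift_eq_of_isGaloisBalancedAlg (dvd_forty h0 h1) hΦ hW hg
    rw [card_filter_eq_sum W S hS (fun r => 2 * (g * r.2).val < 40),
      card_filter_eq_sum W S hS (fun r => ¬2 * (g * r.2).val < 40)] at h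
    exact h
  have e1 := hbal 1 (by decide)
  have e3 := hbal 3 (by decide)
  have e7 := hbal 7 (by decide)
  have e9 := hbal 9 (by decide)
  have s1 : S.filter (fun r => 2 * ((1 : ZMod 40) * r.2).val < 40) = {(0, 5), (1, 1), (1, 3), (1, 7), (1, 9)} := by
    rw [hSdef]; decide
  have s1' : S.filter (fun r => ¬2 * ((1 : ZMod 40) * r.2).val < 40) = {(0, 25), (1, 21), (1, 23), (1, 27), (1, 29)} := by
    rw [hSdef]; decide
  have s3 : S.filter (fun r => 2 * ((3 : ZMod 40) * r.2).val < 40) = {(0, 5), (1, 1), (1, 3), (1, 27), (1, 29)} := by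
    rw [hSdef]; decide
  have s3' : S.filter (fun r => ¬2 * ((3 : ZMod 40) * r.2).val < 40) = {(0, 25), (1, 7), (1, 9), (1, 21), (1, 23)} := by
    rw [hSdef]; decide
  have s7 : S.filter (fun r => 2 * ((7 : ZMod 40) * r.2).val < 40) = {(0, 25), (1, 1), (1, 7), (1, 23), (1, 29)} := by
    rw [hSdef]; decide
  have s7' : S.filter (fun r => ¬2 * ((7 : ZMod 40) * r.2).val < 40) = {(0, 5), (1, 3), (1, 9), (1, 21), (1, 27)} := by
    rw [hSdef]; decide
  have s9 : S.filter (fun r => 2 * ((9 : ZMod 40) * r.2).val < 40) = {(0, 5), (1, 1), (1, 9), (1, 23), (1, 27)} := by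
    rw [hSdef]; decide
  have s9' : S.filter (fun r => ¬2 * ((9 : ZMod 40) * r.2).val < 40) = {(0, 25), (1, 3), (1, 7), (1, 21), (1, 29)} := by
    rw [hSdef]; decide
  rw [s1, s1'] at e1
  rw [s3, s3'] at e3
  rw [s7, s7'] at e7
  rw [s9, s9'] at e9
  rw [Finset.sum_insert (by decide), Finset.sum_insert (by decide), Finset.sum_insert (by decide),
    Finset.sum_insert (by decide), Finset.sum_singleton, Finset.sum_insert (by decide), Finset.sum_insert (by decide),
    Finset.sum_insert (by decide), Finset.sum_insert (by decide), Finset.sum_singleton] at e1 e3 e7 e9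
  have hanti := antipodal_of_four_balances (a0 := a (0, 5)) (a1 := a (0, 25)) (a2 := a (1, 1)) (a3 := a (1, 3))
    (a4 := a (1, 7)) (a5 := a (1, 9)) (a6 := a (1, 21)) (a7 := a (1, 23)) (a8 := a (1, 27)) (a9 := a (1, 29))
    (hle _) (hle _) (by omega) (by omega) (by omega) (by omega)
  -- conclusion, point by point
  have hget : ∀ r : Fin 2 × ZMod 40, 1 ≤ a r → ∃ y ∈ W,
      (⟨y.1, ((40 / lev y.1 * (expOf (lev y.1) (K y.1) y.2).val : ℕ) : ZMod 40)⟩ : Fin 2 × ZMod 40) = r := fun r hr => by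
    obtain ⟨y, hy⟩ := Finset.card_pos.1 (by rw [hadef] at hr; exact hr)
    rw [Finset.mem_filter] at hy
    exact ⟨y, hy.1, hy.2⟩
  have hpos : ∀ x ∈ W, 1 ≤ a ⟨x.1, ((40 / lev x.1 * (expOf (lev x.1) (K x.1) x.2).val : ℕ) : ZMod 40)⟩ := fun x hx =>
    Finset.card_pos.2 ⟨x, Finset.mem_filter.2 ⟨hx, rfl⟩⟩
  intro x hx
  have hmem := hS x hx
  have hx1 := hpos x hx
  rw [hSdef] at hmem
  simp only [Finset.mem_insert, Finset.mem_singleton] at hmem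
  -- in each of the ten cases the antipodal point has the same indicator, hence is present
  have key : ∀ (i : Fin 2) (t : ZMod 40),
      (⟨x.1, ((40 / lev x.1 * (expOf (lev x.1) (K x.1) x.2).val : ℕ) : ZMod 40)⟩ : Fin 2 × ZMod 40) = (i, t) →
      1 ≤ a (i, t + 20) →
      ∃ y ∈ W, y.1 = x.1 ∧ ((40 / lev y.1 * (expOf (lev y.1) (K y.1) y.2).val : ℕ) : ZMod 40) =
        ((40 / lev x.1 * (expOf (lev x.1) (K x.1) x.2).val : ℕ) : ZMod 40) + 20 := by
    rintro i t hpt ha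
    obtain ⟨hi, ht⟩ := Prod.mk.inj hpt
    obtain ⟨y, hy, hyr⟩ := hget _ ha
    obtain ⟨hyi, hyt⟩ := Prod.mk.inj hyr
    exact ⟨y, hy, hyi.trans hi.symm, by rw [hyt, ht]⟩
  obtain ⟨h05, h121, h323, h727, h929⟩ := hanti
  rcases hmem with hpt | hpt | hpt | hpt | hpt | hpt | hpt | hpt | hpt | hpt <;>
    refine key _ _ hpt ?_ <;> rw [hpt] at hx1
  · rw [show (5 : ZMod 40) + 20 = 25 by decide, ← h05]; exact hx1
  · rw [show (25 : ZMod 40) + 20 = 5 by decide, h05]; exact hx1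
  · rw [show (1 : ZMod 40) + 20 = 21 by decide, ← h121]; exact hx1
  · rw [show (3 : ZMod 40) + 20 = 23 by decide, ← h323]; exact hx1
  · rw [show (7 : ZMod 40) + 20 = 27 by decide, ← h727]; exact hx1
  · rw [show (9 : ZMod 40) + 20 = 29 by decide, ← h929]; exact hx1
  · rw [show (21 : ZMod 40) + 20 = 1 by decide, h121]; exact hx1
  · rw [show (23 : ZMod 40) + 20 = 3 by decide, h323]; exact hx1
  · rw [show (27 : ZMod 40) + 20 = 7 by decide, h727]; exact hx1
  · rw [show (29 : ZMod 40) + 20 = 9 by decide, h929]; exact hx1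

/-- Exactly one of two fibre partners (`e + e' ≡ d/2 (mod d)`, `e` odd, `d ∈ {8, 40}`) has a canonical lift. [folklore] -/
private theorem canonical_of_not_canonical {d : ℕ} (hd : d = 8 ∨ d = 40) {e e' : ℕ} (he : e < d) (he' : e' < d)
    (hodd : e % 2 = 1) (hsum : (e + e') % d = d / 2) (hc : ¬(40 / d * e) % 20 < 10) : (40 / d * e') % 20 < 10 := by
  rcases hd with rfl | rfl <;> norm_num at hsum hc ⊢ <;> omega

/-- The exponent of an embedding of `ℚ(ζ_d)`, `d` even, is odd. [folklore] -/
private theorem expOf_val_odd {i : Fin 2} (h2 : 2 ∣ lev i) (σ : K i →+* ℂ) : (expOf (lev i) (K i) σ).val % 2 = 1 := by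
  have h := coprime_expOf (lev i) (K i) σ
  by_contra hv
  have := Nat.dvd_gcd (show 2 ∣ (expOf (lev i) (K i) σ).val by omega) h2
  rw [h] at this
  omega

omit [∀ i, NeZero (lev i)] [∀ i, NumberField (K i)] [∀ i, IsCyclotomicExtension {lev i} ℚ (K i)] in
/-- The levels are `8` and `40`. [folklore] -/
private theorem lev_eq_or (h0 : lev 0 = 8) (h1 : lev 1 = 40) : ∀ i : Fin 2, lev i = 8 ∨ lev i = 40 :=
  Fin.forall_fin_two.2 ⟨Or.inl h0, Or.inr h1⟩

/-- **All lifts are odd** (`5e` resp. `e` with `e` a unit of `ℤ/8` resp. `ℤ/40`). [cite: Washington1997, Thm. 2.5] -/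
theorem lift_val_odd (h0 : lev 0 = 8) (h1 : lev 1 = 40) (x : (i : Fin 2) × (K i →+* ℂ)) :
    ((40 / lev x.1 * (expOf (lev x.1) (K x.1) x.2).val : ℕ) : ZMod 40).val % 2 = 1 := by
  rw [val_lift_forty (dvd_forty h0 h1 x.1)]
  have hd : lev x.1 = 8 ∨ lev x.1 = 40 := lev_eq_or h0 h1 x.1
  have h2 : 2 ∣ lev x.1 := by rcases hd with h | h <;> rw [h] <;> norm_num
  have hodd := expOf_val_odd (i := x.1) h2 x.2
  revert hodd
  generalize (expOf (lev x.1) (K x.1) x.2).val = e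
  intro hodd
  rcases hd with h | h <;> rw [h] <;> norm_num <;> omega

/-- **CANONICAL LIFTS EXIST.**  Over a member `ℚ(ζ_d)` (`d ∈ {8, 40}`) with its index-`2` subfield `L ∋ ζ_d − ζ_d^{−1}`, every embedding
`ρ` of `L` has a lift `σ` (`σ|_L = ρ`) with CANONICAL lifted residue: the two lifts have exponents `e + e' ≡ d/2` (F42
`expOf_eq_or_add_mod_eq_of_apply_eq`), and exactly one of them is canonical. [cite: Shimura1998, §6.2 Thm. 3 (proof)]
[cite: GalleseGoodsonLombardo2024, §3.2 Lemma 11–12] -/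
theorem exists_canonical_lift (h0 : lev 0 = 8) (h1 : lev 1 = 40) {i : Fin 2} {L : IntermediateField ℚ (K i)}
    (hfin : Module.finrank L (K i) = 2) (hζ : zetaOf (lev i) (K i) - (zetaOf (lev i) (K i))⁻¹ ∈ L) (ρ : L →+* ℂ) :
    ∃ σ : K i →+* ℂ, σ.comp (algebraMap L (K i)) = ρ ∧
      ((40 / lev i * (expOf (lev i) (K i) σ).val : ℕ) : ZMod 40).val % 20 < 10 := by
  classical
  have hd : lev i = 8 ∨ lev i = 40 := lev_eq_or h0 h1 i
  have h2 : 2 ∣ lev i := by rcases hd with h | h <;> rw [h] <;> norm_num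
  obtain ⟨a, a', hne, ha, ha', -⟩ := exists_fibre_pair hfin ρ
  by_cases hc : ((40 / lev i * (expOf (lev i) (K i) a).val : ℕ) : ZMod 40).val % 20 < 10
  · exact ⟨a, ha, hc⟩
  refine ⟨a', ha', ?_⟩
  have happ : a (zetaOf (lev i) (K i) - (zetaOf (lev i) (K i))⁻¹) = a' (zetaOf (lev i) (K i) - (zetaOf (lev i) (K i))⁻¹) := by
    have := RingHom.congr_fun (ha.trans ha'.symm) ⟨_, hζ⟩
    simpa using this
  rcases expOf_eq_or_add_mod_eq_of_apply_eq (d := lev i) h2 happ with heq | hsum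
  · exact absurd (expOf_injective (lev i) (K i) heq).symm hne
  rw [val_lift_forty (dvd_forty h0 h1 i)] at hc ⊢
  have hodd := expOf_val_odd (i := i) h2 a
  have hlt := ZMod.val_lt (expOf (lev i) (K i) a)
  have hlt' := ZMod.val_lt (expOf (lev i) (K i) a')
  revert hc hsum hodd hlt hlt'
  generalize (expOf (lev i) (K i) a).val = e
  generalize (expOf (lev i) (K i) a').val = e'
  intro hc hsum hodd hlt hlt'
  exact canonical_of_not_canonical hd hlt hlt' hodd hsum hc

end EightForty

/-! ## §3 `B•(E' ⊕ Y_{40}) = D•`: the Hodge ring of the product of the simple factors of `J_{40}` is generated by divisor classes -/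

section Assembly

variable {lev : Fin 2 → ℕ} [∀ i, NeZero (lev i)] {K : Fin 2 → Type} [∀ i, Field (K i)] [∀ i, NumberField (K i)]
  [∀ i, IsCyclotomicExtension {lev i} ℚ (K i)] {Φ : ∀ i, CMType (K i)}
  {A : Fin 2 → AbelianVariety ℂ} {ι : ∀ i, 𝓞 (K i) →+* End (A i)}
  {θ : ∀ i, K i →+* Module.End ℂ (complexBetti (A i).X 1)}

/-- **EVERY BALANCED WEIGHT OF `(L_8 ⊔ L_40; Ψ_8 ⊔ Ψ_40)` IS DIVISORIAL.**  For sub-pairs `(L_i; Ψ_i)` of `(ℚ(ζ_8); Φ_8)`, `(ℚ(ζ_40); Φ_40)` of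
index `2` containing `ζ − ζ^{−1}` and inducing the lower-half types: `pohlmannSetsAlg Ψ m ⊆ pohlmannDivisorSetsAlg Ψ m` for every `m` — along
the CANONICAL SECTION (a pattern-preserving injection, F42 §0) a balanced `T` becomes a balanced set of canonical points, which is antipodally
closed (§2), hence a disjoint union of antipodal balanced pairs (§1), and divisoriality pulls back.
[cite: MoonenZarhin1999LowDim, Thm. 0.2 (3) and §5 Case 2] [cite: Pohlmann1968, Thm. 1] [cite: Gordon1999HodgeAVSurvey, 9.2.2] -/
theorem pohlmannSetsAlg_subset_pohlmannDivisorSetsAlg_subPair_eight_forty (h0 : lev 0 = 8) (h1 : lev 1 = 40)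
    (hΦ : ∀ i (σ : K i →+* ℂ), σ ∈ (Φ i).1 ↔ 2 * (expOf (lev i) (K i) σ).val < lev i)
    {L : ∀ i, IntermediateField ℚ (K i)} {Ψ : ∀ i, CMType (L i)}
    (hind : ∀ i, inducedCMType (algebraMap (L i) (K i)) (Ψ i) = Φ i) (hfin : ∀ i, Module.finrank (L i) (K i) = 2)
    (hζ : ∀ i, zetaOf (lev i) (K i) - (zetaOf (lev i) (K i))⁻¹ ∈ L i) (m : ℕ) :
    pohlmannSetsAlg Ψ m ⊆ pohlmannDivisorSetsAlg Ψ m := by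
  classical
  intro T hT
  choose S hS hSc using fun (i : Fin 2) (ρ : L i →+* ℂ) => exists_canonical_lift (K := K) h0 h1 (hfin i) (hζ i) ρ
  have hSinj : ∀ i, Function.Injective (S i) := fun i ρ ρ' h => by rw [← hS i ρ, ← hS i ρ', h]
  let f : ((j : Fin 2) × (L j →+* ℂ)) ↪ ((i : Fin 2) × (K i →+* ℂ)) :=
    ⟨fun y => ⟨y.1, S y.1 y.2⟩, by
      rintro ⟨j, ρ⟩ ⟨j', ρ'⟩ h
      simp only [Sigma.mk.injEq] at h
      obtain ⟨rfl, h2⟩ := h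
      rw [hSinj j (eq_of_heq h2)]⟩
  have hf : ∀ (τ : ℂ ≃+* ℂ) (y : (j : Fin 2) × (L j →+* ℂ)),
      (τ : ℂ →+* ℂ).comp (f y).2 ∈ (Φ (f y).1).1 ↔ (τ : ℂ →+* ℂ).comp y.2 ∈ (Ψ y.1).1 := fun τ y => by
    show (τ : ℂ →+* ℂ).comp (S y.1 y.2) ∈ (Φ y.1).1 ↔ _
    rw [← hind y.1, comp_mem_inducedCMType_iff, hS]
  have hW := (map_mem_pohlmannSetsAlg_iff_of_pattern f hf m T).2 hT
  rw [mem_pohlmannSetsAlg_iff] at hW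
  have hcan : ∀ x ∈ T.map f, ((40 / lev x.1 * (expOf (lev x.1) (K x.1) x.2).val : ℕ) : ZMod 40).val % 20 < 10 := by
    intro x hx
    obtain ⟨y, -, rfl⟩ := Finset.mem_map.1 hx
    exact hSc y.1 y.2
  have hpair := antipodal_of_isGaloisBalancedAlg_of_canonical h0 h1 hΦ hW.2 hcan
  have hdiv := mem_pohlmannDivisorSetsAlg_of_antipodal (dvd_forty h0 h1) hΦ m (T.map f) hW.1
    (fun x _ y _ hi hl => eq_of_lift_eq h0 h1 x y hi hl) (fun x _ => lift_val_odd h0 h1 x) hpair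
  exact (map_mem_pohlmannDivisorSetsAlg_iff_of_pattern f hf m T).1 hdiv

/-- **`B•(E' ⊕ Y_{40}) = D•(E' ⊕ Y_{40})` — MOONEN–ZARHIN'S CASE (g) INSIDE `J_{40}`, THE HODGE RING.**  For realisations `A_0 ⊨ (ℚ(ζ_8); Φ_8)`,
`A_1 ⊨ (ℚ(ζ_{40}); Φ_{40})` — the pieces `X_8 ∼ E'²`, `X_{40} ∼ Y_{40}²` of `J_{40}` — the simple factors `B_0 = E'` (the CM elliptic curve of
`ℚ(√−2)`) and `B_1 = Y_{40}` (a simple CM fourfold) of F42 §4 satisfy: `E'`, `Y_{40}` simple, stably nondegenerate, `Hom = 0` both ways,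
`E' × Y_{40}` (dimension `5`) is NOT stably nondegenerate (F42: `E'² × Y_{40}` carries an exceptional `(3,3)`-class, F43) — AND YET **every
rational Hodge class on `E' ⊕ Y_{40}` itself lies in the span of products of divisor classes** (`IsDivisorGenerated`): the tree's CM-algebra
dictionary (`exists_exceptional_biproduct_iff`) and `pohlmannSetsAlg ⊆ pohlmannDivisorSetsAlg` for the sub-pair algebra.  Moonen–Zarhin
Thm. 0.2: «(3) Suppose we are in case (g). Then `B•(X) = D•(X)` but `Hg(X) ≠ Hg(E) × Hg(Y)`» — here for the explicit `X = E' × Y_{40} ⊂ J_{40}`.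
[cite: MoonenZarhin1999LowDim, Thm. 0.2 (3) and §5 Case 2] [cite: GalleseGoodsonLombardo2024, §3 Thm. 3.0 (5)] [cite: Pohlmann1968, Thm. 1]
[cite: Gordon1999HodgeAVSurvey, 9.2.2 and Thm. 7.6.2] -/
theorem exists_simpleFactors_isDivisorGenerated_of_lev_eq_eight_forty (h0 : lev 0 = 8) (h1 : lev 1 = 40)
    (hΦ : ∀ i (σ : K i →+* ℂ), σ ∈ (Φ i).1 ↔ 2 * (expOf (lev i) (K i) σ).val < lev i)
    (hA : ∀ i, IsCMTypeRealisation (Φ i) (A i) (ι i) (θ i)) :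
    ∃ (L : ∀ i, IntermediateField ℚ (K i)) (Ψ : ∀ i, CMType (L i)) (B : Fin 2 → AbelianVariety ℂ)
      (ιB : ∀ i, 𝓞 (L i) →+* End (B i)) (θB : ∀ i, L i →+* Module.End ℂ (complexBetti (B i).X 1)),
      (∀ i, inducedCMType (algebraMap (L i) (K i)) (Ψ i) = Φ i) ∧ (∀ i, Module.finrank (L i) (K i) = 2) ∧
      (∀ i, L i = IntermediateField.adjoin ℚ {zetaOf (lev i) (K i) - (zetaOf (lev i) (K i))⁻¹}) ∧
      (∀ i, IsCMTypeRealisation (Ψ i) (B i) (ιB i) (θB i)) ∧ (∀ i, (B i).IsSimple) ∧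
      (∀ i, IsIsogenous (A i) (⨁ fun _ : Fin 2 => B i)) ∧
      (B 0).dim = 1 ∧ (B 1).dim = 4 ∧ IsStablyNondegenerate (B 0) ∧ IsStablyNondegenerate (B 1) ∧
      (∀ u : B 0 ⟶ B 1, u = 0) ∧ (∀ v : B 1 ⟶ B 0, v = 0) ∧ ((B 0).prod (B 1)).dim = 5 ∧
      ¬IsStablyNondegenerate ((B 0).prod (B 1)) ∧
      (∀ m, pohlmannSetsAlg Ψ m ⊆ pohlmannDivisorSetsAlg Ψ m) ∧ IsDivisorGenerated (⨁ B) := by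
  obtain ⟨L, Ψ, B, ιB, θB, hind, hfin, hL, hB, hs, hiso, hd0, hd1, hB0, hB1, hu, hv, hdimP, hS⟩ :=
    exists_simpleFactors_of_lev_eq_eight_forty h0 h1 hΦ hA
  have hζ : ∀ i, zetaOf (lev i) (K i) - (zetaOf (lev i) (K i))⁻¹ ∈ L i := fun i => by
    rw [hL i]
    exact IntermediateField.subset_adjoin ℚ _ (Set.mem_singleton _)
  have hsub : ∀ m, pohlmannSetsAlg Ψ m ⊆ pohlmannDivisorSetsAlg Ψ m := fun m =>
    pohlmannSetsAlg_subset_pohlmannDivisorSetsAlg_subPair_eight_forty h0 h1 hΦ hind hfin hζ m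
  refine ⟨L, Ψ, B, ιB, θB, hind, hfin, hL, hB, hs, hiso, hd0, hd1, hB0, hB1, hu, hv, hdimP, hS, hsub, ?_⟩
  intro m c hcQ hcH
  by_contra hcD
  obtain ⟨T, hT⟩ := (exists_exceptional_biproduct_iff hB m).1 ⟨c, hcQ, hcH, hcD⟩
  exact hT.2 (hsub m hT.1)

/-- **HYPOTHESIS-FREE: `E' ⊕ Y_{40}` EXISTS — simple CM factors of dimensions `1` and `4`, both stably nondegenerate, `Hom = 0` both ways, with
`E' × Y_{40}` NOT stably nondegenerate, whose own Hodge ring is nevertheless generated by divisor classes** (`IsDivisorGenerated (E' ⊕ Y_{40})`):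
Moonen–Zarhin's case (g), «`B•(X) = D•(X)` but `Hg(X) ≠ Hg(E) × Hg(Y)`», realised inside `J_{40}`; the exceptional classes live on `E'² × Y_{40}`
(F43) and on `X_8 × X_{40} = E'² × Y_{40}²` (F40), not on `E' × Y_{40}`. [cite: MoonenZarhin1999LowDim, Thm. 0.2 (3) and §5 Case 2]
[cite: GalleseGoodsonLombardo2024, §3 Thm. 3.0 (5)] [cite: Gordon1999HodgeAVSurvey, Thm. 7.6.2 and 9.2.2] -/
theorem exists_cmCurve_simple_fourfold_isDivisorGenerated_not_isStablyNondegenerate :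
    ∃ B : Fin 2 → AbelianVariety ℂ, (B 0).IsSimple ∧ (B 1).IsSimple ∧ (B 0).dim = 1 ∧ (B 1).dim = 4 ∧
      IsStablyNondegenerate (B 0) ∧ IsStablyNondegenerate (B 1) ∧ (∀ u : B 0 ⟶ B 1, u = 0) ∧ (∀ v : B 1 ⟶ B 0, v = 0) ∧
      ((B 0).prod (B 1)).dim = 5 ∧ ¬IsStablyNondegenerate ((B 0).prod (B 1)) ∧ IsDivisorGenerated (⨁ B) := by
  obtain ⟨K, _, _, _, _, Φ, A, ι, θ, hΦ, hA⟩ := exists_realisation_family (![8, 40] : Fin 2 → ℕ)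
    (fun i => by fin_cases i <;> decide) (fun i => by fin_cases i <;> decide)
  obtain ⟨L, Ψ, B, ιB, θB, -, -, -, -, hs, -, hd0, hd1, hB0, hB1, hu, hv, hdimP, hS, -, hD⟩ :=
    exists_simpleFactors_isDivisorGenerated_of_lev_eq_eight_forty (lev := (![8, 40] : Fin 2 → ℕ)) (A := A) rfl rfl hΦ hA
  exact ⟨B, hs 0, hs 1, hd0, hd1, hB0, hB1, hu, hv, hdimP, hS, hD⟩

end Assembly

/-! ## §4 `ℚ(√−2) ⊂ ℚ(ζ_{8q} − ζ_{8q}^{−1})` (`q` odd): the CM field of `E'` embeds into the CM field of `Y_{40}` (Moonen–Zarhin's `k ↪ End⁰(Y)`) -/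

section SqrtNegTwo

variable {m : ℕ} [NeZero m] {K : Type} [Field K] [NumberField K] [IsCyclotomicExtension {m} ℚ K]

/-- **`ζ^q − ζ^{−q} ∈ ℚ(ζ − ζ^{−1})` with square `−2`** for `ζ = ζ_m`, `m = 8q`, `q` odd (`m ∉ {24}`, i.e. `q ≠ 3`): the reflection
`γ : ζ ↦ −ζ^{−1}` fixing `L = ℚ(ζ − ζ^{−1})` sends `u = ζ^q` to `−u^{−1}`, so fixes `u − u^{−1}`; and `u⁴ = ζ^{m/2} = −1` gives
`(u − u^{−1})² = u² − 2 + u^{−2} = −2`.  For `m = 40` (`q = 5`): `√−2 ∈ L_{40}`, the CM field of the simple factor `Y_{40}` contains the CM field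
`ℚ(√−2) = ℚ(ζ_8 − ζ_8^{−1})` of `E'` (`m = 8`, `q = 1`) — Moonen–Zarhin's case (g) hypothesis «there exists an embedding `k ↪ End⁰(Y)`» on the
CM-field level. [cite: MoonenZarhin1999LowDim, §5 Case 2 and Thm. 0.2 (3)] [cite: GalleseGoodsonLombardo2024, §3.2 Lemma 11]
[cite: Washington1997, Ch. 2 (basic cyclotomic relations)] -/
theorem zetaOf_pow_sub_inv_mem_and_sq_eq_neg_two_of_eq_adjoin {q : ℕ} (hq : Odd q) (hm : m = 8 * q) (h24 : m ≠ 24)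
    {Φ : CMType K} (hΦ : ∀ σ : K →+* ℂ, σ ∈ Φ.1 ↔ 2 * (expOf m K σ).val < m)
    {L : IntermediateField ℚ K} (hL : L = IntermediateField.adjoin ℚ {zetaOf m K - (zetaOf m K)⁻¹}) :
    zetaOf m K ^ q - (zetaOf m K ^ q)⁻¹ ∈ L ∧ (zetaOf m K ^ q - (zetaOf m K ^ q)⁻¹) ^ 2 = -2 := by
  have hq0 : 0 < q := hq.pos
  have h4 : 4 ∣ m := ⟨2 * q, by rw [hm]; ring⟩
  have h8 : 8 ≤ m := by omega
  have h20 : m ≠ 20 := by omega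
  have h60 : m ≠ 60 := by omega
  obtain ⟨K₁, Φ₁, h₁, hp₁, -⟩ := exists_primitive_inducedCMType_index_two_of_four_dvd h4 h8 h20 h24 h60 Φ hΦ
  obtain ⟨γ, hγ, -, hfix, -, -, -, -, hK₁⟩ := eq_fixedField_and_eq_adjoin_of_primitive_of_four_dvd h4 h8 h20 h24 h60 Φ hΦ Φ₁ h₁ hp₁
  have hLK : L = K₁ := hL.trans hK₁.symm
  subst hLK
  have hprim : IsPrimitiveRoot (zetaOf m K) m := IsCyclotomicExtension.zeta_spec m ℚ K
  have hζ0 : zetaOf m K ≠ 0 := hprim.ne_zero (NeZero.ne m)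
  have hu0 : zetaOf m K ^ q ≠ 0 := pow_ne_zero _ hζ0
  have h4q : (zetaOf m K ^ q) ^ 4 = -1 := by
    rw [← pow_mul]
    exact (hprim.pow (by omega) (show m = q * 4 * 2 by omega)).eq_neg_one_of_two_right
  have hinv2 : ((zetaOf m K ^ q) ^ 2)⁻¹ = -((zetaOf m K ^ q) ^ 2) := by
    refine inv_eq_of_mul_eq_one_right ?_
    rw [mul_neg, ← pow_add, show 2 + 2 = 4 by rfl, h4q, neg_neg]
  refine ⟨(hfix _).2 ?_, ?_⟩
  · rw [map_sub, map_inv₀, map_pow, hγ, neg_pow, hq.neg_one_pow, inv_pow, neg_mul, one_mul, inv_neg, inv_inv]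
    ring
  · rw [sub_sq, mul_assoc, mul_inv_cancel₀ hu0, mul_one, inv_pow, hinv2]
    ring

end SqrtNegTwo

/-! ## §5 Hence THE HODGE CONJECTURE HOLDS FOR `E' ⊕ Y_{40}` (Moonen–Zarhin: `B• = D•` and Lefschetz (1,1)) -/

section HodgeConjecture

variable {lev : Fin 2 → ℕ} [∀ i, NeZero (lev i)] {K : Fin 2 → Type} [∀ i, Field (K i)] [∀ i, NumberField (K i)]
  [∀ i, IsCyclotomicExtension {lev i} ℚ (K i)] {Φ : ∀ i, CMType (K i)}
  {A : Fin 2 → AbelianVariety ℂ} {ι : ∀ i, 𝓞 (K i) →+* End (A i)}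
  {θ : ∀ i, K i →+* Module.End ℂ (complexBetti (A i).X 1)}

/-- **THE HODGE CONJECTURE HOLDS FOR `E' ⊕ Y_{40}`** — the `5`-dimensional product of the simple factors of `J_{40}` (Moonen–Zarhin's case (g)):
`B•(E' ⊕ Y_{40}) = D•` (§3) and divisor classes — hence their products — are algebraic (Lefschetz (1,1), the tree's
`hodgeConjectureFor_of_isDivisorGenerated`).  Note that `E' × Y_{40}` is NOT stably nondegenerate (F42 §4), so this does not come from the
«stably nondegenerate ⟹ HC for all powers» route; on `E'² × Y_{40}` the Weil classes of F43 remain.  «The aim of this note is to extend this to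
arbitrary abelian varieties of dimension `≤ 5`» (Moonen–Zarhin, Introduction); Thm. 0.2 (3): «Suppose we are in case (g). Then the Hodge ring
`B•(X)` is generated by divisor classes, i.e., `B•(X) = D•(X)`». [cite: MoonenZarhin1999LowDim, Thm. 0.2 (3) and Introduction]
[cite: vanGeemen1994HodgeAV, §2.4] [cite: GalleseGoodsonLombardo2024, §3 Thm. 3.0 (5)] -/
theorem exists_simpleFactors_hodgeConjectureFor_of_lev_eq_eight_forty (h0 : lev 0 = 8) (h1 : lev 1 = 40)
    (hΦ : ∀ i (σ : K i →+* ℂ), σ ∈ (Φ i).1 ↔ 2 * (expOf (lev i) (K i) σ).val < lev i)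
    (hA : ∀ i, IsCMTypeRealisation (Φ i) (A i) (ι i) (θ i)) :
    ∃ (L : ∀ i, IntermediateField ℚ (K i)) (Ψ : ∀ i, CMType (L i)) (B : Fin 2 → AbelianVariety ℂ)
      (ιB : ∀ i, 𝓞 (L i) →+* End (B i)) (θB : ∀ i, L i →+* Module.End ℂ (complexBetti (B i).X 1)),
      (∀ i, inducedCMType (algebraMap (L i) (K i)) (Ψ i) = Φ i) ∧ (∀ i, IsCMTypeRealisation (Ψ i) (B i) (ιB i) (θB i)) ∧
      (∀ i, (B i).IsSimple) ∧ (∀ i, IsIsogenous (A i) (⨁ fun _ : Fin 2 => B i)) ∧ (B 0).dim = 1 ∧ (B 1).dim = 4 ∧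
      ¬IsStablyNondegenerate ((B 0).prod (B 1)) ∧ IsDivisorGenerated (⨁ B) ∧ HodgeConjectureFor (⨁ B).dim (⨁ B).X := by
  obtain ⟨L, Ψ, B, ιB, θB, hind, -, -, hB, hs, hiso, hd0, hd1, -, -, -, -, -, hS, -, hD⟩ :=
    exists_simpleFactors_isDivisorGenerated_of_lev_eq_eight_forty h0 h1 hΦ hA
  exact ⟨L, Ψ, B, ιB, θB, hind, hB, hs, hiso, hd0, hd1, hS, hD,
    Literature.AlgebraicGeometry.HodgeTheory.hodgeConjectureFor_of_isDivisorGenerated _ hD⟩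

/-- **HYPOTHESIS-FREE: a `5`-dimensional CM abelian variety `E' ⊕ Y_{40}` — product of a CM elliptic curve and a simple CM fourfold, `Hom = 0`, NOT
stably nondegenerate as a pair — FOR WHICH THE HODGE CONJECTURE HOLDS** (all Hodge classes are polynomials in divisor classes).
[cite: MoonenZarhin1999LowDim, Thm. 0.2 (3)] [cite: vanGeemen1994HodgeAV, §2.4] -/
theorem exists_cmCurve_simple_fourfold_hodgeConjectureFor_not_isStablyNondegenerate :
    ∃ B : Fin 2 → AbelianVariety ℂ, (B 0).IsSimple ∧ (B 1).IsSimple ∧ (B 0).dim = 1 ∧ (B 1).dim = 4 ∧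
      IsStablyNondegenerate (B 0) ∧ IsStablyNondegenerate (B 1) ∧ (∀ u : B 0 ⟶ B 1, u = 0) ∧ (∀ v : B 1 ⟶ B 0, v = 0) ∧
      ¬IsStablyNondegenerate ((B 0).prod (B 1)) ∧ IsDivisorGenerated (⨁ B) ∧ HodgeConjectureFor (⨁ B).dim (⨁ B).X := by
  obtain ⟨B, hs0, hs1, hd0, hd1, hB0, hB1, hu, hv, -, hS, hD⟩ :=
    exists_cmCurve_simple_fourfold_isDivisorGenerated_not_isStablyNondegenerate
  exact ⟨B, hs0, hs1, hd0, hd1, hB0, hB1, hu, hv, hS, hD,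
    Literature.AlgebraicGeometry.HodgeTheory.hodgeConjectureFor_of_isDivisorGenerated _ hD⟩

end HodgeConjecture

end HyperellipticJacobian

end Literature.AlgebraicGeometry.ComplexMultiplication
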